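import Mathlib
import HarnessLib
import Summits.Langlands.Langlands.Statement
import Summits.Langlands.Langlands.Theorems.SkinnerWilesDefectOneEisensteinProModularSeedCuspidalCohomologicalPoint
import Literature.NumberTheory.GaloisRepresentations.OrdinaryGaloisRep
import Literature.NumberTheory.EllipticCurves.FramedTateGaloisRep
import Literature.NumberTheory.Automorphic.BCDTModularity
import Literature.FieldTheory.AlgClosed.PadicAlgClEquivComplex

/-!
# Item `SeedOfQuadraticBaseChange` (stmt-Langlands-15158, route `SkinnerWilesDefectOne`):
# the genuine-regime hypothesis from the cousin split (skeleton v4 of the seed's line)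

Companion of `…Theorems.SkinnerWilesDefectOneSeedOfQuadraticBaseChange`, whose closing composition
`seedOfQuadraticBaseChange_of_genuineRegimeSeed` proves the item modulo seven named facts and ONE
open hypothesis `hgen`, the GENUINE REGIME of the seed (the seed crux `EisensteinProModularSeed`,
stmt-Langlands-12920, verbatim on residual pairs that are not odd-descended with `p ≥ 5`; the line
lead's stub S6').  The lead's reshaped skeleton v4 of the line `descend-raise-basechange`
(`Cruxes/EisensteinProModularSeed/Lines/descend_raise_basechange.lean`) splits that regime along the
planners' cousin graft into three registered stubs — S7a `stub_cousinGaloisPackage` (Galois package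
of a twist-free cousin `E/F` of the residual datum: a frame-conjugate of `E.framedTateGaloisRep p`,
oriented-ordinary of weight `(2, 1)`, level set `S`), S7b `stub_cousinAutomorphic` (Caraiani–Newton
automorphy of the cousin, Satake–Frobenius compatible off `S`), S6'' `stub_genuineNonCousinSeed` (the
seed verbatim on the complement: not odd-descended AND no cousin) — composed over the LANDED
dictionary S5 `stub_cuspidalCohomologicalPoint` (p87504, conditional on the two named facts
`bianchi_cuspidal_regularLAlgebraic_eigenclassExists`, `algebraicWeightEigenclass_continuousPoint`).
This file proves, sorry-free, that implication with the three stub signatures VERBATIM as hypotheses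
(`genuineRegimeSeed_of_cousinSplit`), so that whichever shape the promoted residual takes — S6' or
(S7a, S7b, S6'') — item stmt-Langlands-15158 closes from landed files by composition.  The three
hypotheses are OPEN STATEMENTS of the crux's line, not named facts; nothing here claims them.
-/

set_option linter.dupNamespace false -- project-wide option (lakefile weak.linter.dupNamespace); `Summit.Langlands.Langlands` is the mandated namespace

noncomputable section

namespace Summit.Langlands.Langlands.Theorems.SkinnerWilesDefectOne.SeedOfQuadraticBaseChange

open Summit.Langlands.Langlands.Theorems.SkinnerWilesDefectOne.EisensteinProModularSeed
open Literature.NumberTheory.Automorphic Literature.NumberTheory.GaloisRepresentations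
open Literature.NumberTheory.Automorphic.BigHeckeGLn
open NumberField IsDedekindDomain IsLocalRing Filter Field

/-- **The genuine regime from the cousin split** (skeleton v4 of the line, signatures verbatim).  The
genuine-regime hypothesis `hgen` of `seedOfQuadraticBaseChange_of_genuineRegimeSeed` follows from the
three open stubs of the lead's reshaped skeleton — S7a `stub_cousinGaloisPackage` (Galois package of a
twist-free cousin `E/F` of the residual datum), S7b `stub_cousinAutomorphic` (Caraiani–Newton automorphy
of the cousin, Satake–Frobenius compatible off `S`), S6'' `stub_genuineNonCousinSeed` (the seed verbatim
on the complement: not odd-descended AND no cousin) — together with the two named facts of the landed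
dictionary S5 `stub_cuspidalCohomologicalPoint` (p87504): split on the cousin predicate; with a cousin,
S7a → S7b → S5 (an abstract `ι : ℚ̄_p ≃+* ℂ` from `PadicAlgCl.nonempty_ringEquiv_complex`); without,
S6''. -/
theorem genuineRegimeSeed_of_cousinSplit
    (e₁ : Literature.NumberTheory.Automorphic.bianchi_cuspidal_regularLAlgebraic_eigenclassExists)
    (e₂ : Literature.NumberTheory.Automorphic.algebraicWeightEigenclass_continuousPoint)
    (h₇ : ∀ (F : Type) [Field F] [NumberField F], NumberField.IsTotallyComplex F → Module.finrank ℚ F = 2 →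
      ∀ (p : ℕ) [Fact p.Prime], 5 ≤ p → ∀ (O : ValuationSubring (PadicAlgCl p)),
      O = (Valued.v : Valuation (PadicAlgCl p) NNReal).valuationSubring →
      ∀ (ρ₀ : Field.absoluteGaloisGroup F →* Matrix.GeneralLinearGroup (Fin 2) O)
        (E : WeierstrassCurve F) [E.IsElliptic] (P Q : E.geomTorsion p) (q : IsDedekindDomain.HeightOneSpectrum (NumberField.RingOfIntegers F)),
      P ≠ 0 → (∀ a : ℤ, Q ≠ a • P) →
      (∀ σ : Field.absoluteGaloisGroup F, ∃ a b d : ℤ, σ • P = a • P ∧ σ • Q = b • P + d • Q ∧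
          ((ρ₀ σ).val 0 0 - a : O) ∈ IsLocalRing.maximalIdeal O ∧ ((ρ₀ σ).val 1 1 - d : O) ∈ IsLocalRing.maximalIdeal O) →
      (∀ v : IsDedekindDomain.HeightOneSpectrum (NumberField.RingOfIntegers F), (p : NumberField.RingOfIntegers F) ∈ v.asIdeal →
          (∀ 𝔓 ∈ v.primesAbove, ∀ σ ∈ 𝔓.inertia (Field.absoluteGaloisGroup F), σ • P = P) ∧ E.HasGoodReductionAt v) →
      (∀ v : IsDedekindDomain.HeightOneSpectrum (NumberField.RingOfIntegers F), v ≠ q → (p : NumberField.RingOfIntegers F) ∉ v.asIdeal →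
          (∀ 𝔓 ∈ v.primesAbove, ∀ σ ∈ 𝔓.inertia (Field.absoluteGaloisGroup F),
            ((ρ₀ σ).val 0 0 - 1 : O) ∈ IsLocalRing.maximalIdeal O ∧ ((ρ₀ σ).val 1 1 - 1 : O) ∈ IsLocalRing.maximalIdeal O) →
          E.HasGoodReductionAt v) →
      (E.framedTateGaloisRep p).toGaloisRep.IsIrreducible →
      ∃ (r : Literature.NumberTheory.GaloisRepresentations.FramedGaloisRep F (PadicAlgCl p) 2)
        (r₀ : Field.absoluteGaloisGroup F →* Matrix.GeneralLinearGroup (Fin 2) O)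
        (Pfr : Matrix.GeneralLinearGroup (Fin 2) (PadicAlgCl p)) (S : Set (IsDedekindDomain.HeightOneSpectrum (NumberField.RingOfIntegers F))),
        r = Literature.NumberTheory.GaloisRepresentations.FramedRep.conj Pfr (E.framedTateGaloisRep p) ∧
        r.toGaloisRep.IsIrreducible ∧ r.HasUpperTriangularIntegralModel r₀ ∧
        (∀ g, ((r₀ g).val 0 0 - (ρ₀ g).val 0 0 : O) ∈ IsLocalRing.maximalIdeal O ∧
          ((r₀ g).val 1 1 - (ρ₀ g).val 1 1 : O) ∈ IsLocalRing.maximalIdeal O) ∧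
        (∃ k : ℕ, 2 ≤ k ∧ ∃ m : ℕ, 0 < m ∧ ∀ v : IsDedekindDomain.HeightOneSpectrum (NumberField.RingOfIntegers F), (p : NumberField.RingOfIntegers F) ∈ v.asIdeal →
          ∃ Q : Matrix.GeneralLinearGroup (Fin 2) (PadicAlgCl p),
            Valued.v (Q.val 0 0) ≤ Valued.v (Q.val 1 0) ∧
            ∀ σ, (Q⁻¹ * r.toLocal v σ * Q).val 1 0 = 0 ∧
              (σ ∈ Literature.NumberTheory.GaloisRepresentations.absInertia (v.adicCompletion F) →
                (Q⁻¹ * r.toLocal v σ * Q).val 1 1 ^ m = 1 ∧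
                (Q⁻¹ * r.toLocal v σ * Q).val 0 0 ^ m =
                  algebraMap (Padic p) (PadicAlgCl p)
                    (((Literature.NumberTheory.GaloisRepresentations.GaloisRep.cyclotomicCharacter (v.adicCompletion F) p σ).val : PadicInt p) :
                      Padic p) ^ ((k - 1) * m))) ∧
        S.Finite ∧ (∀ v : IsDedekindDomain.HeightOneSpectrum (NumberField.RingOfIntegers F), (p : NumberField.RingOfIntegers F) ∈ v.asIdeal → v ∈ S) ∧
        (∀ v ∉ S, r.IsUnramifiedAt v) ∧ (∀ v ∉ S, E.HasGoodReductionAt v) ∧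
        (∀ v : IsDedekindDomain.HeightOneSpectrum (NumberField.RingOfIntegers F), v ≠ q → (p : NumberField.RingOfIntegers F) ∉ v.asIdeal →
          (∀ 𝔓 ∈ v.primesAbove, ∀ σ ∈ 𝔓.inertia (Field.absoluteGaloisGroup F),
            ((ρ₀ σ).val 0 0 - 1 : O) ∈ IsLocalRing.maximalIdeal O ∧ ((ρ₀ σ).val 1 1 - 1 : O) ∈ IsLocalRing.maximalIdeal O) →
          v ∉ S))
    (h₈ : ∀ (F : Type) [Field F] [NumberField F], NumberField.IsTotallyComplex F → Module.finrank ℚ F = 2 →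
      ∀ (p : ℕ) [Fact p.Prime] (ι : PadicAlgCl p ≃+* ℂ) (E : WeierstrassCurve F) [E.IsElliptic],
      (∃ ρ₃ : Literature.NumberTheory.GaloisRepresentations.FramedGaloisRep F (ZMod 3) 2, E.IsTorsionGaloisRep 3 ρ₃ ∧
          ∀ g : Matrix.SpecialLinearGroup (Fin 2) (ZMod 3), ∃ σ, ρ₃ σ = Matrix.SpecialLinearGroup.toGL g) →
      ∀ (r : Literature.NumberTheory.GaloisRepresentations.FramedGaloisRep F (PadicAlgCl p) 2)
        (Pfr : Matrix.GeneralLinearGroup (Fin 2) (PadicAlgCl p)),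
      r = Literature.NumberTheory.GaloisRepresentations.FramedRep.conj Pfr (E.framedTateGaloisRep p) →
      ∀ (S : Set (IsDedekindDomain.HeightOneSpectrum (NumberField.RingOfIntegers F))), S.Finite →
      (∀ v : IsDedekindDomain.HeightOneSpectrum (NumberField.RingOfIntegers F), (p : NumberField.RingOfIntegers F) ∈ v.asIdeal → v ∈ S) →
      (∀ v ∉ S, E.HasGoodReductionAt v) →
      ∀ hcpt : Literature.NumberTheory.Automorphic.isCompact_glFiniteIntegralLevel 2 F,
        ∃ (πF : Literature.NumberTheory.Automorphic.CuspidalAutomorphicRepData 2 F hcpt) (T' : Literature.NumberTheory.Automorphic.InfinityType F 2),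
          πF.1.HasInfinityType T' ∧ T'.IsLAlgebraic ∧ T'.IsRegular ∧
          ∀ v ∉ S, Summit.Langlands.SatakeFrobCompatibleAt ι πF.1 r v)
    (h₆ : ∀ (F : Type) [Field F] [NumberField F], NumberField.IsTotallyComplex F → Module.finrank ℚ F = 2 →
      ∀ (p : ℕ) [Fact p.Prime], p ≠ 2 → ∀ (O : ValuationSubring (PadicAlgCl p)),
      O = (Valued.v : Valuation (PadicAlgCl p) NNReal).valuationSubring →
      ∀ (ρ : Literature.NumberTheory.GaloisRepresentations.FramedGaloisRep F (PadicAlgCl p) 2)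
        (ρ₀ : Field.absoluteGaloisGroup F →* Matrix.GeneralLinearGroup (Fin 2) O),
      ρ.toGaloisRep.IsIrreducible → (∀ᶠ v in Filter.cofinite, ρ.IsUnramifiedAt v) →
      ρ.HasUpperTriangularIntegralModel ρ₀ →
      (∃ k : ℕ, 2 ≤ k ∧ ∃ m : ℕ, 0 < m ∧ ∀ v : IsDedekindDomain.HeightOneSpectrum (NumberField.RingOfIntegers F), (p : NumberField.RingOfIntegers F) ∈ v.asIdeal →
        Literature.NumberTheory.GaloisRepresentations.IsPDistinguishedAt ρ₀ v ∧ ∃ Q : Matrix.GeneralLinearGroup (Fin 2) (PadicAlgCl p),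
          Valued.v (Q.val 0 0) ≤ Valued.v (Q.val 1 0) ∧
          ∀ σ, (Q⁻¹ * ρ.toLocal v σ * Q).val 1 0 = 0 ∧
            (σ ∈ Literature.NumberTheory.GaloisRepresentations.absInertia (v.adicCompletion F) →
              (Q⁻¹ * ρ.toLocal v σ * Q).val 1 1 ^ m = 1 ∧
              (Q⁻¹ * ρ.toLocal v σ * Q).val 0 0 ^ m =
                algebraMap (Padic p) (PadicAlgCl p)
                  (((Literature.NumberTheory.GaloisRepresentations.GaloisRep.cyclotomicCharacter (v.adicCompletion F) p σ).val : PadicInt p) :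
                    Padic p) ^ ((k - 1) * m))) →
      ¬ (5 ≤ p ∧ ∃ η : Field.absoluteGaloisGroup ℚ →ₜ* (PadicAlgCl p)ˣ,
      (∀ τ, Valued.v ((η τ : (PadicAlgCl p)ˣ) : PadicAlgCl p) = 1) ∧
      (∀ σ : Field.absoluteGaloisGroup F,
        Valued.v (((η (Literature.NumberTheory.GaloisRepresentations.absGaloisRestrict ℚ F σ) : (PadicAlgCl p)ˣ) : PadicAlgCl p) *
            ((ρ₀ σ).val 0 0 : PadicAlgCl p) - ((ρ₀ σ).val 1 1 : PadicAlgCl p)) < 1) ∧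
      (∀ c : Field.absoluteGaloisGroup ℚ, Literature.NumberTheory.GaloisRepresentations.IsComplexConjugation (Rat.castHom ℝ) c →
        Valued.v (((η c : (PadicAlgCl p)ˣ) : PadicAlgCl p) + 1) < 1)) →
      ¬ (5 ≤ p ∧ ∃ (E : WeierstrassCurve F) (_ : E.IsElliptic) (P Q : E.geomTorsion p) (q : IsDedekindDomain.HeightOneSpectrum (NumberField.RingOfIntegers F)),
        P ≠ 0 ∧ (∀ a : ℤ, Q ≠ a • P) ∧
        (∀ σ : Field.absoluteGaloisGroup F, ∃ a b d : ℤ, σ • P = a • P ∧ σ • Q = b • P + d • Q ∧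
          ((ρ₀ σ).val 0 0 - a : O) ∈ IsLocalRing.maximalIdeal O ∧ ((ρ₀ σ).val 1 1 - d : O) ∈ IsLocalRing.maximalIdeal O) ∧
        (∀ v : IsDedekindDomain.HeightOneSpectrum (NumberField.RingOfIntegers F), (p : NumberField.RingOfIntegers F) ∈ v.asIdeal →
          (∀ 𝔓 ∈ v.primesAbove, ∀ σ ∈ 𝔓.inertia (Field.absoluteGaloisGroup F), σ • P = P) ∧ E.HasGoodReductionAt v) ∧
        (∀ v : IsDedekindDomain.HeightOneSpectrum (NumberField.RingOfIntegers F), v ≠ q → (p : NumberField.RingOfIntegers F) ∉ v.asIdeal →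
          (∀ 𝔓 ∈ v.primesAbove, ∀ σ ∈ 𝔓.inertia (Field.absoluteGaloisGroup F),
            ((ρ₀ σ).val 0 0 - 1 : O) ∈ IsLocalRing.maximalIdeal O ∧ ((ρ₀ σ).val 1 1 - 1 : O) ∈ IsLocalRing.maximalIdeal O) →
          E.HasGoodReductionAt v) ∧
        (∃ ρ₃ : Literature.NumberTheory.GaloisRepresentations.FramedGaloisRep F (ZMod 3) 2, E.IsTorsionGaloisRep 3 ρ₃ ∧
          ∀ g : Matrix.SpecialLinearGroup (Fin 2) (ZMod 3), ∃ σ, ρ₃ σ = Matrix.SpecialLinearGroup.toGL g) ∧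
        (E.framedTateGaloisRep p).toGaloisRep.IsIrreducible) →
      ∃ (𝒰 : Literature.NumberTheory.Automorphic.BigHeckeGLn.TameLevel 2 F p) (r : Literature.NumberTheory.GaloisRepresentations.FramedGaloisRep F (PadicAlgCl p) 2)
        (r₀ : Field.absoluteGaloisGroup F →* Matrix.GeneralLinearGroup (Fin 2) O)
        (q : IsDedekindDomain.HeightOneSpectrum (NumberField.RingOfIntegers F)),
        r.toGaloisRep.IsIrreducible ∧ 𝒰.IsPadicallyAutomorphic r ∧
        r.HasUpperTriangularIntegralModel r₀ ∧
        (∀ g, ((r₀ g).val 0 0 - (ρ₀ g).val 0 0 : O) ∈ IsLocalRing.maximalIdeal O ∧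
          ((r₀ g).val 1 1 - (ρ₀ g).val 1 1 : O) ∈ IsLocalRing.maximalIdeal O) ∧
        (∃ k : ℕ, 2 ≤ k ∧ ∃ m : ℕ, 0 < m ∧ ∀ v : IsDedekindDomain.HeightOneSpectrum (NumberField.RingOfIntegers F), (p : NumberField.RingOfIntegers F) ∈ v.asIdeal →
          ∃ Q : Matrix.GeneralLinearGroup (Fin 2) (PadicAlgCl p),
            Valued.v (Q.val 0 0) ≤ Valued.v (Q.val 1 0) ∧
            ∀ σ, (Q⁻¹ * r.toLocal v σ * Q).val 1 0 = 0 ∧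
              (σ ∈ Literature.NumberTheory.GaloisRepresentations.absInertia (v.adicCompletion F) →
                (Q⁻¹ * r.toLocal v σ * Q).val 1 1 ^ m = 1 ∧
                (Q⁻¹ * r.toLocal v σ * Q).val 0 0 ^ m =
                  algebraMap (Padic p) (PadicAlgCl p)
                    (((Literature.NumberTheory.GaloisRepresentations.GaloisRep.cyclotomicCharacter (v.adicCompletion F) p σ).val : PadicInt p) :
                      Padic p) ^ ((k - 1) * m))) ∧
        (∀ v : IsDedekindDomain.HeightOneSpectrum (NumberField.RingOfIntegers F), v ≠ q → (p : NumberField.RingOfIntegers F) ∉ v.asIdeal →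
          (∀ 𝔓 ∈ v.primesAbove, ∀ σ ∈ 𝔓.inertia (Field.absoluteGaloisGroup F),
            ((ρ₀ σ).val 0 0 - 1 : O) ∈ IsLocalRing.maximalIdeal O ∧ ((ρ₀ σ).val 1 1 - 1 : O) ∈ IsLocalRing.maximalIdeal O) →
          v ∉ 𝒰.bad)) :
    ∀ (F : Type) [Field F] [NumberField F], NumberField.IsTotallyComplex F → Module.finrank ℚ F = 2 →
      ∀ (p : ℕ) [Fact p.Prime], p ≠ 2 → ∀ (O : ValuationSubring (PadicAlgCl p)),
      O = (Valued.v : Valuation (PadicAlgCl p) NNReal).valuationSubring →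
      ∀ (ρ : Literature.NumberTheory.GaloisRepresentations.FramedGaloisRep F (PadicAlgCl p) 2)
        (ρ₀ : Field.absoluteGaloisGroup F →* Matrix.GeneralLinearGroup (Fin 2) O),
      ρ.toGaloisRep.IsIrreducible → (∀ᶠ v in Filter.cofinite, ρ.IsUnramifiedAt v) →
      ρ.HasUpperTriangularIntegralModel ρ₀ →
      (∃ k : ℕ, 2 ≤ k ∧ ∃ m : ℕ, 0 < m ∧ ∀ v : IsDedekindDomain.HeightOneSpectrum (NumberField.RingOfIntegers F), (p : NumberField.RingOfIntegers F) ∈ v.asIdeal →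
        Literature.NumberTheory.GaloisRepresentations.IsPDistinguishedAt ρ₀ v ∧ ∃ Q : Matrix.GeneralLinearGroup (Fin 2) (PadicAlgCl p),
          Valued.v (Q.val 0 0) ≤ Valued.v (Q.val 1 0) ∧
          ∀ σ, (Q⁻¹ * ρ.toLocal v σ * Q).val 1 0 = 0 ∧
            (σ ∈ Literature.NumberTheory.GaloisRepresentations.absInertia (v.adicCompletion F) →
              (Q⁻¹ * ρ.toLocal v σ * Q).val 1 1 ^ m = 1 ∧
              (Q⁻¹ * ρ.toLocal v σ * Q).val 0 0 ^ m =
                algebraMap (Padic p) (PadicAlgCl p)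
                  (((Literature.NumberTheory.GaloisRepresentations.GaloisRep.cyclotomicCharacter (v.adicCompletion F) p σ).val : PadicInt p) :
                    Padic p) ^ ((k - 1) * m))) →
      ¬ (5 ≤ p ∧ ∃ η : Field.absoluteGaloisGroup ℚ →ₜ* (PadicAlgCl p)ˣ,
      (∀ τ, Valued.v ((η τ : (PadicAlgCl p)ˣ) : PadicAlgCl p) = 1) ∧
      (∀ σ : Field.absoluteGaloisGroup F,
        Valued.v (((η (Literature.NumberTheory.GaloisRepresentations.absGaloisRestrict ℚ F σ) : (PadicAlgCl p)ˣ) : PadicAlgCl p) *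
            ((ρ₀ σ).val 0 0 : PadicAlgCl p) - ((ρ₀ σ).val 1 1 : PadicAlgCl p)) < 1) ∧
      (∀ c : Field.absoluteGaloisGroup ℚ, Literature.NumberTheory.GaloisRepresentations.IsComplexConjugation (Rat.castHom ℝ) c →
        Valued.v (((η c : (PadicAlgCl p)ˣ) : PadicAlgCl p) + 1) < 1)) →
      ∃ (𝒰 : Literature.NumberTheory.Automorphic.BigHeckeGLn.TameLevel 2 F p) (r : Literature.NumberTheory.GaloisRepresentations.FramedGaloisRep F (PadicAlgCl p) 2)
        (r₀ : Field.absoluteGaloisGroup F →* Matrix.GeneralLinearGroup (Fin 2) O)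
        (q : IsDedekindDomain.HeightOneSpectrum (NumberField.RingOfIntegers F)),
        r.toGaloisRep.IsIrreducible ∧ 𝒰.IsPadicallyAutomorphic r ∧
        r.HasUpperTriangularIntegralModel r₀ ∧
        (∀ g, ((r₀ g).val 0 0 - (ρ₀ g).val 0 0 : O) ∈ IsLocalRing.maximalIdeal O ∧
          ((r₀ g).val 1 1 - (ρ₀ g).val 1 1 : O) ∈ IsLocalRing.maximalIdeal O) ∧
        (∃ k : ℕ, 2 ≤ k ∧ ∃ m : ℕ, 0 < m ∧ ∀ v : IsDedekindDomain.HeightOneSpectrum (NumberField.RingOfIntegers F), (p : NumberField.RingOfIntegers F) ∈ v.asIdeal →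
          ∃ Q : Matrix.GeneralLinearGroup (Fin 2) (PadicAlgCl p),
            Valued.v (Q.val 0 0) ≤ Valued.v (Q.val 1 0) ∧
            ∀ σ, (Q⁻¹ * r.toLocal v σ * Q).val 1 0 = 0 ∧
              (σ ∈ Literature.NumberTheory.GaloisRepresentations.absInertia (v.adicCompletion F) →
                (Q⁻¹ * r.toLocal v σ * Q).val 1 1 ^ m = 1 ∧
                (Q⁻¹ * r.toLocal v σ * Q).val 0 0 ^ m =
                  algebraMap (Padic p) (PadicAlgCl p)
                    (((Literature.NumberTheory.GaloisRepresentations.GaloisRep.cyclotomicCharacter (v.adicCompletion F) p σ).val : PadicInt p) :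
                      Padic p) ^ ((k - 1) * m))) ∧
        (∀ v : IsDedekindDomain.HeightOneSpectrum (NumberField.RingOfIntegers F), v ≠ q → (p : NumberField.RingOfIntegers F) ∉ v.asIdeal →
          (∀ 𝔓 ∈ v.primesAbove, ∀ σ ∈ 𝔓.inertia (Field.absoluteGaloisGroup F),
            ((ρ₀ σ).val 0 0 - 1 : O) ∈ IsLocalRing.maximalIdeal O ∧ ((ρ₀ σ).val 1 1 - 1 : O) ∈ IsLocalRing.maximalIdeal O) →
          v ∉ 𝒰.bad) := by
  intro F _ _ hF hdeg p _ hp O hO ρ ρ₀ hirr hunr hmod hloc hP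
  by_cases hC : (5 ≤ p ∧ ∃ (E : WeierstrassCurve F) (_ : E.IsElliptic) (P Q : E.geomTorsion p) (q : HeightOneSpectrum (𝓞 F)),
        P ≠ 0 ∧ (∀ a : ℤ, Q ≠ a • P) ∧
        (∀ σ : absoluteGaloisGroup F, ∃ a b d : ℤ, σ • P = a • P ∧ σ • Q = b • P + d • Q ∧
          ((ρ₀ σ).val 0 0 - a : O) ∈ maximalIdeal O ∧ ((ρ₀ σ).val 1 1 - d : O) ∈ maximalIdeal O) ∧
        (∀ v : HeightOneSpectrum (𝓞 F), (p : 𝓞 F) ∈ v.asIdeal →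
          (∀ 𝔓 ∈ v.primesAbove, ∀ σ ∈ 𝔓.inertia (absoluteGaloisGroup F), σ • P = P) ∧ E.HasGoodReductionAt v) ∧
        (∀ v : HeightOneSpectrum (𝓞 F), v ≠ q → (p : 𝓞 F) ∉ v.asIdeal →
          (∀ 𝔓 ∈ v.primesAbove, ∀ σ ∈ 𝔓.inertia (absoluteGaloisGroup F),
            ((ρ₀ σ).val 0 0 - 1 : O) ∈ maximalIdeal O ∧ ((ρ₀ σ).val 1 1 - 1 : O) ∈ maximalIdeal O) →
          E.HasGoodReductionAt v) ∧
        (∃ ρ₃ : FramedGaloisRep F (ZMod 3) 2, E.IsTorsionGaloisRep 3 ρ₃ ∧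
          ∀ g : Matrix.SpecialLinearGroup (Fin 2) (ZMod 3), ∃ σ, ρ₃ σ = Matrix.SpecialLinearGroup.toGL g) ∧
        (E.framedTateGaloisRep p).toGaloisRep.IsIrreducible)
  · obtain ⟨hp5, E, hE, P, Q, q, hPne, hQ, hact, hatp, hlev, hbig, hVirr⟩ := hC
    -- S7a: the Galois package of the cousin
    obtain ⟨r, r₀, Pfr, S, hr, hrirr, hrmod, hrdiag, hrord, hSfin, hSp, hSunr, hSgood, hSlev⟩ :=
      h₇ F hF hdeg p hp5 O hO ρ₀ E P Q q hPne hQ hact hatp hlev hVirr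
    -- S7b: Caraiani–Newton automorphy of the cousin, Satake–Frobenius compatible with `r` off `S`
    obtain ⟨ι⟩ := PadicAlgCl.nonempty_ringEquiv_complex (p := p)
    obtain ⟨πF, T', hT', hT'L, hT'R, hcompatF⟩ :=
      h₈ F hF hdeg p ι E hbig r Pfr hr S hSfin hSp hSgood (isCompact_glFiniteIntegralLevel_holds 2 F)
    -- S5 (landed p87504): the dictionary
    obtain ⟨𝒰, hbad, hpa⟩ :=
      stub_cuspidalCohomologicalPoint e₁ e₂ F hF hdeg p (isCompact_glFiniteIntegralLevel_holds 2 F) ι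
        πF T' hT' hT'L hT'R S hSfin hSp r hcompatF
    exact ⟨𝒰, r, r₀, q, hrirr, hpa, hrmod, hrdiag, hrord, fun v hvq hvp hur => hbad ▸ hSlev v hvq hvp hur⟩
  · exact h₆ F hF hdeg p hp O hO ρ ρ₀ hirr hunr hmod hloc hP hC

end Summit.Langlands.Langlands.Theorems.SkinnerWilesDefectOne.SeedOfQuadraticBaseChange

end
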